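import Mathlib

/-!
# Crux `SignCone.ConeMagnification` (stmt-RiemannHypothesis-16303), line `Sketch` r8, stub `stub_designOfTypes`:
# the discrete Fejér averaging over rotated designs

Seat-0 programme for the open core `stub_designOfTypes` (design algebra §3, the rotation device).  The killer
designs are rotated by the unit complex numbers `ω_j = −exp(2π i j/N)`; averaging the resulting type inequalities
with the nonnegative weights `w_j = 1 + cos(2π j/N)` isolates the first harmonic (the prime classes) and kills
every composite harmonic `2 ≤ k ≤ N − 2`:

* `sum_cos_mul_eq_zero` / `sum_cos_mul_eq_card` — `Σ_{j<N} cos(2π m j/N) = 0` for `N ∤ m`, `= N` for `m = 0`;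
* `fejerSum_one`, `fejerSum_eq_zero` — `Σ_{j<N} (1 + cos(2πj/N)) cos(2π k j/N) = N/2` for `k = 1` (`N ≥ 3`) and
  `= 0` for `2 ≤ k ≤ N − 2`;
* `rotUnit_ne_zero`, `conj_rotUnit`, `re_rotUnit_pow` — `ω_j ≠ 0`, `ω̄_j = ω_j⁻¹`,
  `Re(ω_j^k) = (−1)^k cos(2π k j/N)`; `one_add_cos_nonneg` — the weights are `≥ 0`.
-/

noncomputable section

-- `Summit.RiemannHypothesis.RiemannHypothesis.…` repeats a namespace component by design (D-0017 layout).
set_option linter.dupNamespace false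

open Finset Complex
open scoped BigOperators ComplexConjugate Real

namespace Summit.RiemannHypothesis.RiemannHypothesis.Theorems.SignConeConeMagnification

namespace Design

/-! ### Sums of cosines over the `N`-th roots of unity -/

/-- `Σ_{j<N} exp(2π i m j/N) = 0` when `N ∤ m`. [folklore] -/
theorem sum_exp_mul_eq_zero (N m : ℕ) (hN : 0 < N) (hm : ¬ N ∣ m) :
    ∑ j ∈ Finset.range N, Complex.exp (2 * π * I * m * j / N) = 0 := by
  set ζ : ℂ := Complex.exp (2 * π * I * m / N) with hζ
  have hpow : ∀ j : ℕ, Complex.exp (2 * π * I * m * j / N) = ζ ^ j := by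
    intro j
    rw [hζ, ← Complex.exp_nat_mul]
    congr 1
    ring
  simp_rw [hpow]
  have hζ1 : ζ ≠ 1 := by
    intro h
    rw [hζ, Complex.exp_eq_one_iff] at h
    obtain ⟨n, hn⟩ := h
    have hN0 : (N : ℂ) ≠ 0 := by exact_mod_cast hN.ne'
    have h2 : (m : ℂ) = n * N := by
      have h2πI : (2 * π * I : ℂ) ≠ 0 := by
        simp [Real.pi_ne_zero, Complex.I_ne_zero]
      field_simp at hn
      rw [hn, mul_comm]
    -- so `N ∣ m`
    apply hm
    have h3 : (m : ℤ) = n * N := by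
      have : ((m : ℤ) : ℂ) = ((n * N : ℤ) : ℂ) := by push_cast; exact h2
      exact_mod_cast this
    exact Int.natCast_dvd_natCast.1 ⟨n, by rw [h3]; ring⟩
  have hζN : ζ ^ N = 1 := by
    rw [hζ, ← Complex.exp_nat_mul, Complex.exp_eq_one_iff]
    refine ⟨m, ?_⟩
    have hN0 : (N : ℂ) ≠ 0 := by exact_mod_cast hN.ne'
    field_simp
    push_cast
    ring
  rw [geom_sum_eq hζ1, hζN, sub_self, zero_div]

/-- `Σ_{j<N} cos(2π m j/N) = 0` when `N ∤ m`. [folklore] -/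
theorem sum_cos_mul_eq_zero (N m : ℕ) (hN : 0 < N) (hm : ¬ N ∣ m) :
    ∑ j ∈ Finset.range N, Real.cos (2 * π * m * j / N) = 0 := by
  have h := congrArg Complex.re (sum_exp_mul_eq_zero N m hN hm)
  rw [Complex.re_sum, Complex.zero_re] at h
  rw [← h]
  refine Finset.sum_congr rfl fun j _ => ?_
  rw [show (2 * π * I * m * j / N : ℂ) = ((2 * π * m * j / N : ℝ) : ℂ) * I by push_cast; ring,
    Complex.exp_ofReal_mul_I_re]

/-- `Σ_{j<N} cos(2π · 0 · j/N) = N`. [folklore] -/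
theorem sum_cos_zero_mul (N : ℕ) : ∑ j ∈ Finset.range N, Real.cos (2 * π * (0 : ℕ) * j / N) = N := by
  simp

/-! ### The Fejér weights `1 + cos(2πj/N)` against the harmonics -/

/-- First harmonic: `Σ_{j<N} (1 + cos(2πj/N)) cos(2πj/N) = N/2` for `N ≥ 3`. [folklore] -/
theorem fejerSum_one (N : ℕ) (hN : 3 ≤ N) :
    ∑ j ∈ Finset.range N, (1 + Real.cos (2 * π * j / N)) * Real.cos (2 * π * (1 : ℕ) * j / N) = N / 2 := by
  have h1 : ∑ j ∈ Finset.range N, Real.cos (2 * π * (1 : ℕ) * j / N) = 0 :=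
    sum_cos_mul_eq_zero N 1 (by omega) (fun h => by have := Nat.le_of_dvd one_pos h; omega)
  have h2 : ∑ j ∈ Finset.range N, Real.cos (2 * π * (2 : ℕ) * j / N) = 0 :=
    sum_cos_mul_eq_zero N 2 (by omega) (fun h => by have := Nat.le_of_dvd two_pos h; omega)
  have hcs : ∀ j : ℕ, (1 + Real.cos (2 * π * j / N)) * Real.cos (2 * π * (1 : ℕ) * j / N) =
      Real.cos (2 * π * (1 : ℕ) * j / N) + (1 / 2 + Real.cos (2 * π * (2 : ℕ) * j / N) / 2) := by
    intro j
    have e1 : (2 * π * (1 : ℕ) * j / N : ℝ) = 2 * π * j / N := by push_cast; ring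
    have e2 : (2 * π * (2 : ℕ) * j / N : ℝ) = 2 * (2 * π * j / N) := by push_cast; ring
    rw [e1, e2, Real.cos_two_mul]
    ring
  simp_rw [hcs]
  rw [Finset.sum_add_distrib, h1, zero_add, Finset.sum_add_distrib, Finset.sum_const, Finset.card_range,
    ← Finset.sum_div, h2, nsmul_eq_mul]
  ring

/-- Composite harmonics: `Σ_{j<N} (1 + cos(2πj/N)) cos(2π k j/N) = 0` for `2 ≤ k ≤ N − 2`. [folklore] -/
theorem fejerSum_eq_zero (N k : ℕ) (hk : 2 ≤ k) (hkN : k + 2 ≤ N) :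
    ∑ j ∈ Finset.range N, (1 + Real.cos (2 * π * j / N)) * Real.cos (2 * π * k * j / N) = 0 := by
  have hN : 0 < N := by omega
  have hndvd : ∀ m : ℕ, 0 < m → m < N → ¬ N ∣ m := fun m hm0 hmN h => by
    have := Nat.le_of_dvd hm0 h; omega
  have h0 : ∑ j ∈ Finset.range N, Real.cos (2 * π * k * j / N) = 0 :=
    sum_cos_mul_eq_zero N k hN (hndvd k (by omega) (by omega))
  have hp : ∑ j ∈ Finset.range N, Real.cos (2 * π * (k + 1 : ℕ) * j / N) = 0 :=
    sum_cos_mul_eq_zero N (k + 1) hN (hndvd (k + 1) (by omega) (by omega))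
  have hm : ∑ j ∈ Finset.range N, Real.cos (2 * π * (k - 1 : ℕ) * j / N) = 0 :=
    sum_cos_mul_eq_zero N (k - 1) hN (hndvd (k - 1) (by omega) (by omega))
  have hcs : ∀ j : ℕ, (1 + Real.cos (2 * π * j / N)) * Real.cos (2 * π * k * j / N) =
      Real.cos (2 * π * k * j / N) + (Real.cos (2 * π * (k + 1 : ℕ) * j / N) / 2 +
        Real.cos (2 * π * (k - 1 : ℕ) * j / N) / 2) := by
    intro j
    have hk1 : ((k - 1 : ℕ) : ℝ) = (k : ℝ) - 1 := by
      rw [Nat.cast_sub (by omega)]; simp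
    have e1 : (2 * π * (k + 1 : ℕ) * j / N : ℝ) = 2 * π * k * j / N + 2 * π * j / N := by push_cast; ring
    have e2 : (2 * π * (k - 1 : ℕ) * j / N : ℝ) = 2 * π * k * j / N - 2 * π * j / N := by
      rw [hk1]; ring
    rw [e1, e2, Real.cos_add, Real.cos_sub]
    ring
  simp_rw [hcs]
  rw [Finset.sum_add_distrib, h0, Finset.sum_add_distrib, ← Finset.sum_div, ← Finset.sum_div, hp, hm]
  simp

/-- The Fejér weights are nonnegative. [folklore] -/
theorem one_add_cos_nonneg (x : ℝ) : 0 ≤ 1 + Real.cos x := by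
  have := Real.neg_one_le_cos x
  linarith

/-- The total weight: `Σ_{j<N} (1 + cos(2πj/N)) = N` for `N ≥ 2`. [folklore] -/
theorem fejerSum_weights (N : ℕ) (hN : 2 ≤ N) :
    ∑ j ∈ Finset.range N, (1 + Real.cos (2 * π * j / N)) = N := by
  have h1 : ∑ j ∈ Finset.range N, Real.cos (2 * π * (1 : ℕ) * j / N) = 0 :=
    sum_cos_mul_eq_zero N 1 (by omega) (fun h => by have := Nat.le_of_dvd one_pos h; omega)
  have e : ∀ j : ℕ, (2 * π * j / N : ℝ) = 2 * π * (1 : ℕ) * j / N := fun j => by push_cast; ring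
  simp_rw [e]
  rw [Finset.sum_add_distrib, h1]
  simp

/-! ### The rotation units `ω_j = −exp(2π i j/N)` -/

/-- `ω = −exp(iθ)` is nonzero. [folklore] -/
theorem rotUnit_ne_zero (θ : ℝ) : (-Complex.exp (θ * I) : ℂ) ≠ 0 :=
  neg_ne_zero.2 (Complex.exp_ne_zero _)

/-- `ω = −exp(iθ)` is unitary: `ω̄ = ω⁻¹`. [folklore] -/
theorem conj_rotUnit (θ : ℝ) : (starRingEnd ℂ) (-Complex.exp (θ * I)) = (-Complex.exp (θ * I))⁻¹ := by
  rw [map_neg, ← Complex.exp_conj, map_mul, Complex.conj_ofReal, Complex.conj_I, mul_neg,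
    Complex.exp_neg, inv_neg]

/-- `Re(ω^k) = (−1)^k cos(kθ)` for `ω = −exp(iθ)`. [folklore] -/
theorem re_rotUnit_pow (θ : ℝ) (k : ℕ) :
    ((-Complex.exp (θ * I)) ^ k).re = (-1) ^ k * Real.cos (k * θ) := by
  rw [neg_pow, ← Complex.exp_nat_mul, show ((-1 : ℂ)) ^ k = (((-1 : ℝ) ^ k : ℝ) : ℂ) by push_cast; rfl,
    Complex.re_ofReal_mul, show ((k : ℂ) * (θ * I)) = ((k * θ : ℝ) : ℂ) * I by push_cast; ring,
    Complex.exp_ofReal_mul_I_re]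

/-- `Re(ω^k) = cos(kθ)` for `ω = exp(iθ)`. [folklore] -/
theorem re_exp_pow (θ : ℝ) (k : ℕ) : ((Complex.exp (θ * I)) ^ k).re = Real.cos (k * θ) := by
  rw [← Complex.exp_nat_mul,
    show ((k : ℂ) * (θ * I)) = ((k * θ : ℝ) : ℂ) * I by push_cast; ring, Complex.exp_ofReal_mul_I_re]

/-- `exp(iθ)` is unitary. [folklore] -/
theorem conj_expUnit (θ : ℝ) : (starRingEnd ℂ) (Complex.exp (θ * I)) = (Complex.exp (θ * I))⁻¹ := by
  rw [← Complex.exp_conj, map_mul, Complex.conj_ofReal, Complex.conj_I, mul_neg, Complex.exp_neg]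

/-- **Registered sub-goal `designFejer`** (seat-0 anchor of this file, design algebra §3 of the proof of
`stub_designOfTypes`): the Fejér weights `1 + cos(2πj/N)` pick out the first harmonic (`N/2`) and kill the
harmonics `2 ≤ k ≤ N − 2` over the `N`-th roots of unity. [folklore] -/
theorem designFejer : ∀ N : ℕ, 3 ≤ N →
    (∑ j ∈ Finset.range N, (1 + Real.cos (2 * π * j / N)) * Real.cos (2 * π * (1 : ℕ) * j / N) = N / 2) ∧
    (∀ k : ℕ, 2 ≤ k → k + 2 ≤ N →
      ∑ j ∈ Finset.range N, (1 + Real.cos (2 * π * j / N)) * Real.cos (2 * π * k * j / N) = 0) :=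
  fun N hN => ⟨fejerSum_one N hN, fun k hk hkN => fejerSum_eq_zero N k hk hkN⟩

end Design

end Summit.RiemannHypothesis.RiemannHypothesis.Theorems.SignConeConeMagnification
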